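import Summits.QuantumFields.QCD.Theses.HeatSlicedQuarks
import Summits.QuantumFields.QCD.Theorems.HeatSlicedQuarksInterleavedHeatSliceFlowStubParametrixLate
import Summits.QuantumFields.QCD.Theorems.HeatSlicedQuarksInterleavedHeatSliceFlowStubOffDiagLogProfile
import Summits.QuantumFields.QCD.Theorems.HeatSlicedQuarksInterleavedHeatSliceFlowStubImageSum
import Summits.QuantumFields.QCD.Theorems.HeatSlicedQuarksInterleavedHeatSliceFlowStubGlobalCombGauge
import Summits.QuantumFields.QCD.Theorems.HeatSlicedQuarksInterleavedHeatSliceFlowStubHoppingWeightedBounds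
import Summits.QuantumFields.QCD.Theorems.HeatSlicedQuarksInterleavedHeatSliceFlowStubFreeColumnProfile
import Summits.QuantumFields.QCD.Theorems.HeatSlicedQuarksInterleavedHeatSliceFlowStubFreeWeightedMoments
import Summits.QuantumFields.QCD.Theorems.HeatSlicedQuarksInterleavedHeatSliceFlowStubColumnIdentification
import Summits.QuantumFields.QCD.Theorems.HeatSlicedQuarksInterleavedHeatSliceFlowStubInteriorAssembly
import Summits.QuantumFields.QCD.Theorems.HeatSlicedQuarksInterleavedHeatSliceFlowStubPeriodizationAssembly

/-!
# The small-field on-diagonal parametrix for Wilson fermions (line `Sketch`, crux `InterleavedHeatSliceFlow`, item stmt-QuantumFields-8891)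

**ParametrixDiagonalLog** (reshape r4 of line `Sketch`; card transported-parametrix-counterterms, first lemma).  There are
`ε > 0`, `C`, `c > 0` such that on every discrete four-torus `T_L`, for every `SU(3)` lattice gauge field `U` whose
plaquette deficits are GLOBALLY scale-covariantly small, `3 − Re tr U_p ≤ (ε/r²)²` (`1 ≤ r ≤ L`), every bare mass
`m ∈ [-1/2, 1]` and every proper time `1 ≤ t ≤ r²`, every colour–spin entry of the on-diagonal heat kernel of
`H_U = D_W(U)ᴴ D_W(U)` (`r = 1` Wilson fermions) equals the FREE one up to the relative error `C ε t/r²` and a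
winding tail:

  `|e^{-tH_U}((x,a,α),(x,b,β)) − e^{-tH_1}((x,a,α),(x,b,β))| ≤ C (εt/r²)/t² + C e^{-c L²/(t(1+log t)²)}/t²`.

It is the composition of the nine landed stubs of reshape r4 (`stub_offDiagLogProfile`, `stub_imageSum`,
`stub_globalCombGauge`, `stub_hoppingWeightedBounds`, `stub_freeColumnProfile`, `stub_freeWeightedMoments`,
`stub_columnIdentification`, `stub_interiorAssembly`, `stub_periodizationAssembly`) with the late bound
`stub_parametrixLate` (the closed crux 8871 twice) outside the regime `t(1+log t)² ≤ L²`.  The linear law inside the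
regime is `parametrixCoreLog_holds`.
-/

noncomputable section

namespace Summit.QuantumFields.QCD.Cruxes.InterleavedHeatSliceFlow.Sketch

open Literature.MathematicalPhysics.QuantumLattice Literature.MathematicalPhysics.QuantumFieldTheory
  Literature.Probability.LatticeModels
open Summit.QuantumFields.QCD.Theses.HeatSlicedQuarks
open scoped Matrix

/-- **The log-regime parametrix core** (linear law): under global `(ε/r²)²`-smallness, for `1 ≤ t ≤ r²` with
`t(1+log t)² ≤ L²`, `|e^{-tH_U}(x,x)_{aα,bβ} − e^{-tH_1}(x,x)_{aα,bβ}| ≤ C(εt/r²)/t²`.  Composition of the r4 stubs. -/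
theorem parametrixCoreLog_holds :
    ∃ ε : ℝ, 0 < ε ∧ ∃ C : ℝ, ∀ (L : ℕ) [NeZero L]
      (U : GaugeConfig 4 L (Matrix.specialUnitaryGroup (Fin 3) ℂ)) (m : ℝ), m ∈ Set.Icc (-(1 / 2 : ℝ)) 1 →
      ∀ (r : ℕ), 1 ≤ r → r ≤ L →
      (∀ (y : TorusSite 4 L) (μ ν : Fin 4),
        3 - ((fundamentalRep (Fin 3)) (plaquetteHolonomy U y μ ν)).trace.re ≤ (ε / (r : ℝ) ^ 2) ^ 2) →
      ∀ (t : ℝ), 1 ≤ t → t ≤ (r : ℝ) ^ 2 → t * (1 + Real.log t) ^ 2 ≤ (L : ℝ) ^ 2 →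
      ∀ (x : TorusSite 4 L) (a b : Fin 3) (α β : Fin 4),
        ‖(NormedSpace.exp (-(t : ℂ) • ((wilsonDirac (fundamentalRep (Fin 3)) U m 1)ᴴ *
              wilsonDirac (fundamentalRep (Fin 3)) U m 1))) (x, a, α) (x, b, β) -
            (NormedSpace.exp (-(t : ℂ) •
              ((wilsonDirac (fundamentalRep (Fin 3))
                  (fun _ : Edge 4 L => (1 : Matrix.specialUnitaryGroup (Fin 3) ℂ)) m 1)ᴴ *
                wilsonDirac (fundamentalRep (Fin 3))
                  (fun _ : Edge 4 L => (1 : Matrix.specialUnitaryGroup (Fin 3) ℂ)) m 1))) (x, a, α) (x, b, β)‖ ≤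
          C * (ε * t / (r : ℝ) ^ 2) / t ^ 2 :=
  stub_periodizationAssembly stub_offDiagLogProfile stub_imageSum
    (stub_interiorAssembly stub_globalCombGauge
      (stub_columnIdentification stub_hoppingWeightedBounds stub_freeColumnProfile stub_freeWeightedMoments))

/-- Elementary: for `1 ≤ t`, `0 < t (1 + log t)²`. -/
theorem regimeFun_pos' {t : ℝ} (ht : 1 ≤ t) : 0 < t * (1 + Real.log t) ^ 2 := by
  have hlog : 0 ≤ Real.log t := Real.log_nonneg ht
  have h1 : 0 < 1 + Real.log t := by linarith
  have ht0 : 0 < t := lt_of_lt_of_le one_pos ht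
  positivity

/-- **Winding regime, log form** (no stub: 8871 twice via the landed `stub_parametrixLate`): if `0 < t` and
`L₂ < t (1+log t)²`-type regime `L₂ / φ ≤ 1` with `φ > 0`, then `C/t² ≤ max C 0 · e · e^{-L₂/φ}/t²`. -/
theorem windingLog_const_le' {C t L₂ φ : ℝ} (ht : 0 < t) (hφ : 0 < φ) (hL : L₂ ≤ φ) :
    C / t ^ 2 ≤ max C 0 * Real.exp 1 * Real.exp (-(L₂ / φ)) / t ^ 2 := by
  have ht2 : 0 < t ^ 2 := by positivity
  refine div_le_div_of_nonneg_right ?_ ht2.le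
  have hexp : 1 ≤ Real.exp 1 * Real.exp (-(L₂ / φ)) := by
    rw [← Real.exp_add]
    refine Real.one_le_exp ?_
    have hdiv : L₂ / φ ≤ 1 := by rwa [div_le_one hφ]
    linarith
  have hM0 : 0 ≤ max C 0 := le_max_right _ _
  calc C ≤ max C 0 * 1 := by rw [mul_one]; exact le_max_left _ _
    _ ≤ max C 0 * (Real.exp 1 * Real.exp (-(L₂ / φ))) := mul_le_mul_of_nonneg_left hexp hM0
    _ = max C 0 * Real.exp 1 * Real.exp (-(L₂ / φ)) := (mul_assoc _ _ _).symm

/-- **ParametrixDiagonalLog** (the small-field on-diagonal parametrix with winding tail; see the module docstring):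
the log-regime core `parametrixCoreLog_holds` inside `t(1+log t)² ≤ L²`, the late bound `stub_parametrixLate`
(`C/t² ≤ C e · e^{-L²/(t(1+log t)²)}/t²`) outside; `c = 1`, `ε = min ε_core ε_late`. -/
theorem parametrixDiagonalLog_holds :
    ∃ ε : ℝ, 0 < ε ∧ ∃ C c : ℝ, 0 < c ∧ ∀ (L : ℕ) [NeZero L]
      (U : GaugeConfig 4 L (Matrix.specialUnitaryGroup (Fin 3) ℂ)) (m : ℝ), m ∈ Set.Icc (-(1 / 2 : ℝ)) 1 →
      ∀ (r : ℕ), 1 ≤ r → r ≤ L →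
      (∀ (y : TorusSite 4 L) (μ ν : Fin 4),
        3 - ((fundamentalRep (Fin 3)) (plaquetteHolonomy U y μ ν)).trace.re ≤ (ε / (r : ℝ) ^ 2) ^ 2) →
      ∀ (t : ℝ), 1 ≤ t → t ≤ (r : ℝ) ^ 2 → ∀ (x : TorusSite 4 L) (a b : Fin 3) (α β : Fin 4),
        ‖(NormedSpace.exp (-(t : ℂ) • ((wilsonDirac (fundamentalRep (Fin 3)) U m 1)ᴴ *
              wilsonDirac (fundamentalRep (Fin 3)) U m 1))) (x, a, α) (x, b, β) -
            (NormedSpace.exp (-(t : ℂ) •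
              ((wilsonDirac (fundamentalRep (Fin 3))
                  (fun _ : Edge 4 L => (1 : Matrix.specialUnitaryGroup (Fin 3) ℂ)) m 1)ᴴ *
                wilsonDirac (fundamentalRep (Fin 3))
                  (fun _ : Edge 4 L => (1 : Matrix.specialUnitaryGroup (Fin 3) ℂ)) m 1))) (x, a, α) (x, b, β)‖ ≤
          C * (ε * t / (r : ℝ) ^ 2) / t ^ 2 + C * Real.exp (-(c * (L : ℝ) ^ 2 / (t * (1 + Real.log t) ^ 2))) / t ^ 2 := by
  obtain ⟨ε₁, hε₁, C₁, h₁⟩ := parametrixCoreLog_holds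
  obtain ⟨ε₂, hε₂, C₂, h₂⟩ := stub_parametrixLate
  set ε : ℝ := min ε₁ ε₂ with hεdef
  have hε : 0 < ε := lt_min hε₁ hε₂
  have hεle₁ : ε ≤ ε₁ := min_le_left _ _
  have hεle₂ : ε ≤ ε₂ := min_le_right _ _
  set C : ℝ := max (max (C₁ * ε₁ / ε) (max C₂ 0 * Real.exp 1)) 0 with hCdef
  have hC0 : 0 ≤ C := le_max_right _ _
  have hCge₁ : C₁ * ε₁ / ε ≤ C := (le_max_left _ _).trans (le_max_left _ _)
  have hCge₂ : max C₂ 0 * Real.exp 1 ≤ C := (le_max_right _ _).trans (le_max_left _ _)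
  refine ⟨ε, hε, C, 1, one_pos, ?_⟩
  intro L _ U m hm r hr hrL hsmall t ht htr x a b α β
  have hr0 : (0 : ℝ) < (r : ℝ) := by exact_mod_cast (Nat.lt_of_lt_of_le Nat.zero_lt_one hr)
  have hr2 : (0 : ℝ) < (r : ℝ) ^ 2 := by positivity
  have ht0 : (0 : ℝ) < t := lt_of_lt_of_le one_pos ht
  have ht2 : (0 : ℝ) < t ^ 2 := by positivity
  have hφ : 0 < t * (1 + Real.log t) ^ 2 := regimeFun_pos' ht
  -- smallness with `ε` implies smallness with `ε₁` and with `ε₂`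
  have hmono : ∀ ε' : ℝ, ε ≤ ε' → ∀ (y : TorusSite 4 L) (μ ν : Fin 4),
      3 - ((fundamentalRep (Fin 3)) (plaquetteHolonomy U y μ ν)).trace.re ≤ (ε' / (r : ℝ) ^ 2) ^ 2 := by
    intro ε' hle y μ ν
    refine (hsmall y μ ν).trans ?_
    have h1 : 0 ≤ ε / (r : ℝ) ^ 2 := div_nonneg hε.le hr2.le
    have h2 : ε / (r : ℝ) ^ 2 ≤ ε' / (r : ℝ) ^ 2 := div_le_div_of_nonneg_right hle hr2.le
    exact pow_le_pow_left₀ h1 h2 2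
  -- both right-hand terms are nonnegative
  have hT1 : 0 ≤ C * (ε * t / (r : ℝ) ^ 2) / t ^ 2 :=
    div_nonneg (mul_nonneg hC0 (div_nonneg (mul_nonneg hε.le ht0.le) hr2.le)) ht2.le
  have hT2 : 0 ≤ C * Real.exp (-(1 * (L : ℝ) ^ 2 / (t * (1 + Real.log t) ^ 2))) / t ^ 2 :=
    div_nonneg (mul_nonneg hC0 (Real.exp_pos _).le) ht2.le
  by_cases hreg : t * (1 + Real.log t) ^ 2 ≤ (L : ℝ) ^ 2
  · -- core regime
    have hcore := h₁ L U m hm r hr hrL (hmono ε₁ hεle₁) t ht htr hreg x a b α β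
    refine hcore.trans ?_
    have hstep : C₁ * (ε₁ * t / (r : ℝ) ^ 2) / t ^ 2 ≤ C * (ε * t / (r : ℝ) ^ 2) / t ^ 2 := by
      have hq : 0 ≤ t / (r : ℝ) ^ 2 / t ^ 2 := by positivity
      have key : C₁ * (ε₁ * t / (r : ℝ) ^ 2) / t ^ 2 = (C₁ * ε₁ / ε) * ε * (t / (r : ℝ) ^ 2 / t ^ 2) := by
        field_simp
      have key' : C * (ε * t / (r : ℝ) ^ 2) / t ^ 2 = C * ε * (t / (r : ℝ) ^ 2 / t ^ 2) := by
        field_simp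
      rw [key, key']
      exact mul_le_mul_of_nonneg_right (mul_le_mul_of_nonneg_right hCge₁ hε.le) hq
    linarith
  · -- winding regime: `L² < t (1 + log t)²`
    push Not at hreg
    have hlate := h₂ L U m hm r hr hrL (hmono ε₂ hεle₂) t ht htr x a b α β
    refine hlate.trans ?_
    have hstep : C₂ / t ^ 2 ≤ C * Real.exp (-(1 * (L : ℝ) ^ 2 / (t * (1 + Real.log t) ^ 2))) / t ^ 2 := by
      rw [one_mul]
      refine (windingLog_const_le' (C := C₂) ht0 hφ hreg.le).trans ?_
      exact div_le_div_of_nonneg_right (mul_le_mul_of_nonneg_right hCge₂ (Real.exp_pos _).le) ht2.le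
    linarith

end Summit.QuantumFields.QCD.Cruxes.InterleavedHeatSliceFlow.Sketch

end
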